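import Summits.BirchSwinnertonDyer.BirchSwinnertonDyer.Theorems.CyclotomicUntwistRohrlichAtLevel
import Literature.NumberTheory.EllipticCurves.KatoTwistedFinitenessTowerRankProofs
import HarnessLib

/-!
# Kato's Thm. 14.4 (rank form) in the cyclotomic `ℤ_p`-tower at a prime `p` DIVIDING the conductor

Cell `pub/bsd-wall` (D-0145 line `route-BirchSwinnertonDyer-CyclotomicUntwist`), seat `bsd-line-cycu-p5`
(width seat 5), helper toward crux K1 `PSRankOneLowerHalfAtThree` (stmt-BirchSwinnertonDyer-21580): on
the principal-series rows `3⁴ ∥ N`, and the finite-slope road works in the cyclotomic `ℤ₃`-tower — this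
file records that the Mordell–Weil ranks of `E` up that tower are BOUNDED (given Kato's Cor. 14.3 (2)),
although `3 ∣ N`. THEOREMS ONLY (no definition, no named fact, no `sorry`); BSD is not proved by this
file and no crux is; the result is CONDITIONAL on the tree's named fact
`kato_finite_chiPart_of_twistedLValue_ne_zero` (Kato 2004, Cor. 14.3 (2)), exactly like its `p ∤ N`
model.

The tree's `exists_forall_mordellWeilRank_cyclotomic_prime_pow_le_of_kato`
(`KatoTwistedFinitenessTowerRankProofs`; Kato 2004 Thm. 14.4, p. 236: "deduced from Cor. 14.3 by using
the theorem of Rohrlich") needs `p ∤ N` ONLY because its Rohrlich input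
(`Rohrlich1984_nonvanishing_twists_holds`) does — its module docstring records the case `m` not prime
to `N` as a TODO ([Ro2]). For `m = p` prime that input is now `PSRohrlichAtLevel.rohrlich_primePow_of_isNewformOf`
(companion `CyclotomicUntwistRohrlichAtLevel`: Rohrlich's theorem for `E/ℚ` and `P = {p}` at ANY prime,
via the Atkin–Lehner flip), so:

* `exists_forall_mordellWeilRank_cyclotomic_le_of_kato_prime` — for `E/ℚ` with newform `f`, ANY prime
  `p`, and GIVEN `hK`: one bound `B` with `rank_ℤ E(ℚ(ζ_M)) ≤ B` for every `p`-power-smooth level `M`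
  (verbatim the tree's assembly: uniform level `p^{n₀}` containing the conductors of Rohrlich's finite
  exceptional set, `sigma_primitiveCharacter_mem_of_not_exists`, `finrank_point_cyclotomic_le_of_kato`,
  `finrank_point_cyclotomic_mono`);
* `exists_forall_mordellWeilRank_cyclotomic_prime_pow_le_of_kato_anyPrime` — **the ranks
  `rank_ℤ E(ℚ(ζ_{pⁿ}))`, `n ≥ 0`, are bounded, for EVERY prime `p` (good or bad)** — Mazur's question for
  the cyclotomic `ℤ_p`-tower after Kato–Rohrlich, with `p ∤ N` removed;
* `exists_forall_mordellWeilRank_cyclotomic_prime_pow_eq_of_kato_anyPrime` — the rank stabilises: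
  `rank E(ℚ(ζ_{pⁿ})) = rank E(ℚ(ζ_{p^{n₁}}))` for `n ≥ n₁`.

(The files live under `Summits/…/Theorems` because the Rohrlich-at-level input does; a Literature
re-homing would move both.)

References: K. Kato, Astérisque 295 (2004), Thm. 14.4 (p. 236) [cite: Kato2004Asterisque, Thm. 14.4 (p. 236)];
D. E. Rohrlich, Invent. Math. 75 (1984) [cite: RohrlichInventiones1984, Theorem (p. 409)].
-/

noncomputable section

open scoped BigOperators

open WeierstrassCurve CongruenceSubgroup DirichletCharacter Literature.NumberTheory.EllipticCurves
  Literature.NumberTheory.EllipticCurves.ModularForms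
  Summit.BirchSwinnertonDyer.BirchSwinnertonDyer.Theorems.PSRohrlichAtLevel

-- single-conjunct summit: `Summit.BirchSwinnertonDyer.BirchSwinnertonDyer.…` repeats the name by design
set_option linter.dupNamespace false
set_option autoImplicit false

namespace Summit.BirchSwinnertonDyer.BirchSwinnertonDyer.Theorems.PSKatoTowerRankAtLevel

/-- **Kato's Thm. 14.4 (rank form) at `p`-power-smooth levels, ANY prime `p`.** For an elliptic
curve `E = W/ℚ` with newform `f ∈ S₂(Γ₀(N))`, a prime `p` (dividing `N` or not) and GIVEN Kato's
Cor. 14.3 (2) (`hK`): there is `B` with `rank_ℤ E(ℚ(ζ_M)) ≤ B` for every level `M` whose only prime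
factor is `p`. Proof verbatim as `exists_forall_mordellWeilRank_cyclotomic_le_of_kato` (`m = p`), the
finite exceptional set being `rohrlich_primePow_of_isNewformOf` (no `p ∤ N`).
[cite: Kato2004Asterisque, Thm. 14.4 (p. 236)] -/
theorem exists_forall_mordellWeilRank_cyclotomic_le_of_kato_prime
    (hK : kato_finite_chiPart_of_twistedLValue_ne_zero)
    (W : WeierstrassCurve ℚ) [W.IsElliptic] {N : ℕ} [NeZero N] {f : CuspForm (Gamma0 N) 2}
    (hf : IsNewformOf W f) {p : ℕ} (hp : p.Prime) :
    ∃ B : ℕ, ∀ (M : ℕ) [NeZero M], M.primeFactors ⊆ p.primeFactors →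
      (W.baseChange (CyclotomicField M ℚ)).mordellWeilRank ≤ B := by
  haveI : Fact p.Prime := ⟨hp⟩
  haveI : NeZero p := ⟨hp.ne_zero⟩
  -- Rohrlich's finite exceptional set for `P = {p} = prime(p)` and the uniform level `p ^ n₀`
  have hS : Set.Finite {χ : Σ k : ℕ, DirichletCharacter ℂ k |
      χ.1 ≠ 0 ∧ χ.1.primeFactors ⊆ p.primeFactors ∧ χ.2.IsPrimitive ∧
        ∃ L : ℂ → ℂ, Differentiable ℂ L ∧
          (∀ s : ℂ, 2 < s.re → L s = twistedLSeries f χ.2 s) ∧ L 1 = 0} := by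
    rw [hp.primeFactors]
    exact rohrlich_primePow_of_isNewformOf (p := p) hf
  set n₀ : ℕ := hS.toFinset.sup Sigma.fst with hn₀
  have hexc : ∀ (M : ℕ) [NeZero M], M.primeFactors ⊆ p.primeFactors →
      ∀ χ : DirichletCharacter ℂ M,
        (¬ ∃ L : ℂ → ℂ, Differentiable ℂ L ∧
          (∀ s : ℂ, 2 < s.re → L s = twistedLSeries f χ s) ∧ L 1 ≠ 0) →
        χ.conductor ∣ p ^ n₀ := by
    intro M _ hM χ hχ
    have hmem := sigma_primitiveCharacter_mem_of_not_exists hf hM χ hχ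
    have hle : χ.conductor ≤ n₀ := Finset.le_sup (f := Sigma.fst) (hS.mem_toFinset.mpr hmem)
    exact (dvd_pow_self_of_primeFactors_subset χ.conductor_ne_zero (NeZero.ne p) hmem.2.1).trans
      (pow_dvd_pow p hle)
  refine ⟨Nat.card (DirichletCharacter ℂ (p ^ n₀)) *
      (W.baseChange (CyclotomicField (p ^ n₀) ℚ)).mordellWeilRank, fun M _ hM => ?_⟩
  haveI : NeZero (M * p ^ n₀) := ⟨mul_ne_zero (NeZero.ne M) (pow_ne_zero _ (NeZero.ne p))⟩
  have hM' : (M * p ^ n₀).primeFactors ⊆ p.primeFactors := by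
    rw [Nat.primeFactors_mul (NeZero.ne M) (pow_ne_zero _ (NeZero.ne p))]
    refine Finset.union_subset hM ?_
    rcases Nat.eq_zero_or_pos n₀ with h0 | h0
    · rw [h0, pow_zero, Nat.primeFactors_one]; exact Finset.empty_subset _
    · rw [Nat.primeFactors_pow p h0.ne']
  exact (finrank_point_cyclotomic_mono W (dvd_mul_right M (p ^ n₀))).trans
    (finrank_point_cyclotomic_le_of_kato hK W hf (M₀ := p ^ n₀) (M := M * p ^ n₀)
      (dvd_mul_left (p ^ n₀) M) (hexc (M * p ^ n₀) hM'))

/-- **Mazur's question for the cyclotomic `ℤ_p`-tower at ANY prime `p`, after Kato–Rohrlich:** for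
an elliptic curve `E/ℚ` with newform `f ∈ S₂(Γ₀(N))` and a prime `p` — of good OR bad reduction — the
ranks `rank_ℤ E(ℚ(ζ_{pⁿ}))`, `n ≥ 0`, are bounded, GIVEN Kato's Cor. 14.3 (2) (`hK`). The tree's
`exists_forall_mordellWeilRank_cyclotomic_prime_pow_le_of_kato` is the case `p ∤ N`.
[cite: Kato2004Asterisque, Thm. 14.4 (p. 236)] -/
theorem exists_forall_mordellWeilRank_cyclotomic_prime_pow_le_of_kato_anyPrime
    (hK : kato_finite_chiPart_of_twistedLValue_ne_zero)
    (W : WeierstrassCurve ℚ) [W.IsElliptic] {N : ℕ} [NeZero N] {f : CuspForm (Gamma0 N) 2}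
    (hf : IsNewformOf W f) {p : ℕ} (hp : p.Prime) :
    ∃ B : ℕ, ∀ n : ℕ, (W.baseChange (CyclotomicField (p ^ n) ℚ)).mordellWeilRank ≤ B := by
  haveI : NeZero p := ⟨hp.ne_zero⟩
  obtain ⟨B, hB⟩ := exists_forall_mordellWeilRank_cyclotomic_le_of_kato_prime hK W hf hp
  refine ⟨B, fun n => ?_⟩
  haveI : NeZero (p ^ n) := ⟨pow_ne_zero _ hp.ne_zero⟩
  refine hB (p ^ n) ?_
  rcases Nat.eq_zero_or_pos n with rfl | hn
  · rw [pow_zero, Nat.primeFactors_one]; exact Finset.empty_subset _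
  · rw [Nat.primeFactors_pow p hn.ne']

/-- **The rank stabilises in the tower `ℚ(ζ_{pⁿ})`, ANY prime `p`** (Kato's Thm. 14.4, rank form, as
`(∪_n E(ℚ(ζ_{pⁿ}))) ⊗ ℚ = E(ℚ(ζ_{p^{n₁}})) ⊗ ℚ`), GIVEN `hK`: there is `n₁` with
`rank_ℤ E(ℚ(ζ_{pⁿ})) = rank_ℤ E(ℚ(ζ_{p^{n₁}}))` for all `n ≥ n₁` (the ranks increase along the tower,
`finrank_point_cyclotomic_mono`, and are bounded). [cite: Kato2004Asterisque, Thm. 14.4 (p. 236)] -/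
theorem exists_forall_mordellWeilRank_cyclotomic_prime_pow_eq_of_kato_anyPrime
    (hK : kato_finite_chiPart_of_twistedLValue_ne_zero)
    (W : WeierstrassCurve ℚ) [W.IsElliptic] {N : ℕ} [NeZero N] {f : CuspForm (Gamma0 N) 2}
    (hf : IsNewformOf W f) {p : ℕ} (hp : p.Prime) :
    ∃ n₁ : ℕ, ∀ n : ℕ, n₁ ≤ n →
      (W.baseChange (CyclotomicField (p ^ n) ℚ)).mordellWeilRank =
        (W.baseChange (CyclotomicField (p ^ n₁) ℚ)).mordellWeilRank := by
  obtain ⟨B, hB⟩ := exists_forall_mordellWeilRank_cyclotomic_prime_pow_le_of_kato_anyPrime hK W hf hp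
  -- the rank sequence is monotone and bounded, hence eventually constant
  set r : ℕ → ℕ := fun n ↦ (W.baseChange (CyclotomicField (p ^ n) ℚ)).mordellWeilRank with hr
  have hmono : Monotone r := by
    refine monotone_nat_of_le_succ fun n ↦ ?_
    haveI : NeZero (p ^ n) := ⟨pow_ne_zero _ hp.ne_zero⟩
    haveI : NeZero (p ^ (n + 1)) := ⟨pow_ne_zero _ hp.ne_zero⟩
    exact finrank_point_cyclotomic_mono W (pow_dvd_pow p (Nat.le_succ n))
  -- a maximal value is attained
  classical
  obtain ⟨n₁, hn₁⟩ : ∃ n₁, ∀ n, r n ≤ r n₁ := by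
    by_contra h
    push Not at h
    -- then `r` takes at least `B + 2` distinct increasing values: impossible
    have hstep : ∀ n, ∃ n', r n < r n' := fun n ↦ h n
    choose g hg using hstep
    have hiter : ∀ k, k ≤ r (g^[k] 0) := by
      intro k
      induction k with
      | zero => exact Nat.zero_le _
      | succ k ih =>
        rw [Function.iterate_succ_apply']
        exact Nat.succ_le_of_lt (lt_of_le_of_lt ih (hg _))
    have := hiter (B + 1)
    have hle := hB (g^[B + 1] 0)
    simp only [hr] at this hle
    omega
  refine ⟨n₁, fun n hn ↦ le_antisymm (hn₁ n) (hmono hn)⟩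

end Summit.BirchSwinnertonDyer.BirchSwinnertonDyer.Theorems.PSKatoTowerRankAtLevel

end
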